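import Literature.Analysis.FluidPDE.PassiveScalarForcedEnergy
import Literature.Analysis.FluidPDE.PassiveScalarForcedRenormalized
import Literature.Analysis.FluidPDE.PassiveScalarForcedMollified
import Literature.Analysis.FluidPDE.PassiveScalarForcedSpectralMeasurability
import Literature.Analysis.FluidPDE.PassiveScalarSteadyTest
import Literature.Analysis.FluidPDE.ScalarSpectralPoincare
import Literature.Analysis.FluidPDE.DEIJCriterion
import Literature.Analysis.FluidPDE.AgeDecouplingWindows
import Literature.Analysis.FluidPDE.LerayHopfSpectralMeasurability
import Literature.Analysis.FluidPDE.LongTimeAverageSubadditive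
import Literature.Analysis.FluidPDE.AlexakisDoeringProofs
import HarnessLib

/-!
# Budgets of a steadily sourced weak passive scalar: energy, variance, trace of the power input

Analysis/FluidPDE proof-support file (everything proved). For `κ > 0`, a smooth steady source
`h`, an `L²` datum and a GLOBAL weak solution `θ` of `∂ₜθ + u·∇θ = κΔθ + h`
(`Torus.IsWeakScalarTransportForced`) over a drift with `∫₀ᵀ ‖∇u‖_{L²} < ∞` for every `T`, we
collect the inputs `(H1)`, `(H3)` and the honesty facts of the age-decoupling argument
(`FluidPDE/AgeDecouplingInequality`), all derived from the sourced energy inequality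
(`PassiveScalarForcedEnergy`):

* the power input `t ↦ ∫ θ(t) h` has the absolutely continuous representative
  `P(t) = ∫ θ₀ h + ∫_{(0,t]} (∫ θ (⟪u, ∇h⟫ + κΔh) + ∫ h²)` on `(0, ∞)` (`ae_integral_mul_eq_trace`),
  continuous with modulus `|P(t₂) - P(t₁)| ≤ ∫_{t₁}^{t₂} |P'|` (`abs_trace_sub_le`);
* `(H1)`: `∫₀ᵀ κ‖∇θ‖² ≤ ½∫θ₀² + ∫₀ᵀ P` for every `T > 0` (`intervalIntegral_dissipation_le`), with
  the dissipation rate `q = κ (eScalarGradNormSq θ)`.toReal integrable on every `(0,T]`;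
* `(H3)`: `P² ≤ (∫h²) ‖θ‖²` a.e. (`ae_trace_sq_le`), and `‖θ(t)‖² = scalarL2Sq (θ t)` is locally
  integrable in time (`integrableOn_scalarL2Sq`).

## References

* T. D. Drivas, T. M. Elgindi, G. Iyer, I.-J. Jeong, ARMA 243 (2022), (1.1)–(1.3). [`DEIJ2022`]
* C. R. Doering, C. Foias, J. Fluid Mech. 467 (2002), §2 (energy/variance budgets). [`DoeringFoias2002`]
-/

noncomputable section

open MeasureTheory TopologicalSpace Set Function Filter Topology UnitAddTorus
open scoped ENNReal NNReal InnerProductSpace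

namespace Literature.Analysis.FluidPDE

namespace Torus

variable {d : Type*} [Fintype d]

section Budget

variable {κ : ℝ} {u : ℝ → UnitAddTorus d → EuclideanSpace ℝ d} {h : UnitAddTorus d → ℝ}
  {θ₀ : UnitAddTorus d → ℝ} {θ : ℝ → UnitAddTorus d → ℝ}

/-! ## The trace of the power input -/

/-- **The power input has an absolutely continuous representative on `(0, ∞)`**: for a.e.
`t > 0`, `∫ θ(t) h = ∫ θ₀ h + ∫_{(0,t]} (∫ θ(τ) (⟪u(τ), ∇h⟫ + κ Δh) + ∫ h²) dτ`
(`PassiveScalarSteadyTest` on every `(0, N)`). [cite: DEIJ2022, (1.1)] -/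
theorem ae_integral_mul_eq_trace (hθ : IsWeakScalarTransportForced κ u (fun _ => h) θ₀ θ)
    (hh : FunctionSpaces.Torus.IsSmooth h) :
    ∀ᵐ t ∂((volume : Measure ℝ).restrict (Ioi 0)),
      ∫ y, θ t y * h y = (∫ y, θ₀ y * h y) + ∫ τ in Ioc 0 t, ((∫ y, θ τ y *
        (⟪u τ y, FunctionSpaces.Torus.gradient h y⟫_ℝ + κ * FunctionSpaces.Torus.laplacian h y)) + ∫ y, h y * h y) := by
  rw [Ioi_zero_eq_iUnion_Ioo_nat, ae_restrict_iUnion_iff]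
  intro n
  rcases Nat.eq_zero_or_pos n with hn | hn
  · subst hn; simp
  · have h1 := (hθ n (by exact_mod_cast hn)).ae_integral_mul_eq hh
    filter_upwards [h1] with t ht
    simpa only using ht

/-- The integrand of the trace, `τ ↦ ∫ θ(τ) (⟪u, ∇h⟫ + κΔh) + ∫ h²`, is integrable on every
`(0, T)`. [folklore] -/
theorem integrableOn_traceDeriv (hθ : IsWeakScalarTransportForced κ u (fun _ => h) θ₀ θ)
    (hh : FunctionSpaces.Torus.IsSmooth h) {T : ℝ} (hT : 0 < T) :
    IntegrableOn (fun τ => (∫ y, θ τ y *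
        (⟪u τ y, FunctionSpaces.Torus.gradient h y⟫_ℝ + κ * FunctionSpaces.Torus.laplacian h y)) + ∫ y, h y * h y)
      (Ioo 0 T) volume :=
  ((hθ T hT).integrable_mul_steadyFlux hh).integral_prod_left.add (integrableOn_const measure_Ioo_lt_top.ne)

/-- **The trace is continuous on `[0, T]`.** [folklore] -/
theorem continuousOn_trace (hθ : IsWeakScalarTransportForced κ u (fun _ => h) θ₀ θ)
    (hh : FunctionSpaces.Torus.IsSmooth h) (T : ℝ) :
    ContinuousOn (fun t => (∫ y, θ₀ y * h y) + ∫ τ in Ioc 0 t, ((∫ y, θ τ y *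
        (⟪u τ y, FunctionSpaces.Torus.gradient h y⟫_ℝ + κ * FunctionSpaces.Torus.laplacian h y)) + ∫ y, h y * h y))
      (Icc 0 T) := by
  rcases le_or_gt T 0 with hT | hT
  · intro t ht
    have : t = 0 := le_antisymm (ht.2.trans hT) ht.1
    subst this
    refine (continuousWithinAt_const.add ?_)
    rw [Icc_eq_singleton_iff.2 ⟨rfl, le_antisymm hT ht.2⟩]
    exact continuousWithinAt_singleton
  · have hi : IntegrableOn (fun τ => (∫ y, θ τ y *
        (⟪u τ y, FunctionSpaces.Torus.gradient h y⟫_ℝ + κ * FunctionSpaces.Torus.laplacian h y)) + ∫ y, h y * h y)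
        (Icc 0 T) volume := (integrableOn_traceDeriv hθ hh hT).congr_set_ae Ioo_ae_eq_Icc.symm
    exact continuousOn_const.add (intervalIntegral.continuousOn_primitive hi)

/-- **Modulus of the trace**: for `0 ≤ t₁ ≤ t₂`,
`|P(t₂) - P(t₁)| ≤ ∫_{t₁}^{t₂} |∫ θ (⟪u, ∇h⟫ + κΔh) + ∫ h²|`. [folklore] -/
theorem abs_trace_sub_le (hθ : IsWeakScalarTransportForced κ u (fun _ => h) θ₀ θ)
    (hh : FunctionSpaces.Torus.IsSmooth h) {t₁ t₂ : ℝ} (ht₁ : 0 ≤ t₁) (ht : t₁ ≤ t₂) :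
    |((∫ y, θ₀ y * h y) + ∫ τ in Ioc 0 t₂, ((∫ y, θ τ y *
        (⟪u τ y, FunctionSpaces.Torus.gradient h y⟫_ℝ + κ * FunctionSpaces.Torus.laplacian h y)) + ∫ y, h y * h y)) -
      ((∫ y, θ₀ y * h y) + ∫ τ in Ioc 0 t₁, ((∫ y, θ τ y *
        (⟪u τ y, FunctionSpaces.Torus.gradient h y⟫_ℝ + κ * FunctionSpaces.Torus.laplacian h y)) + ∫ y, h y * h y))| ≤
      ∫ τ in t₁..t₂, |(∫ y, θ τ y *
        (⟪u τ y, FunctionSpaces.Torus.gradient h y⟫_ℝ + κ * FunctionSpaces.Torus.laplacian h y)) + ∫ y, h y * h y| := by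
  set F : ℝ → ℝ := fun τ => (∫ y, θ τ y *
    (⟪u τ y, FunctionSpaces.Torus.gradient h y⟫_ℝ + κ * FunctionSpaces.Torus.laplacian h y)) + ∫ y, h y * h y with hF
  have hFi : IntegrableOn F (Ioc 0 (t₂ + 1)) volume :=
    (integrableOn_traceDeriv hθ hh (by linarith)).congr_set_ae Ioo_ae_eq_Ioc.symm
  have h1 : IntervalIntegrable F volume 0 t₁ :=
    (intervalIntegrable_iff_integrableOn_Ioc_of_le ht₁).2 (hFi.mono_set (Ioc_subset_Ioc_right (by linarith)))
  have h2 : IntervalIntegrable F volume t₁ t₂ :=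
    (intervalIntegrable_iff_integrableOn_Ioc_of_le ht).2 (hFi.mono_set (Ioc_subset_Ioc ht₁ (by linarith)))
  have e : ((∫ y, θ₀ y * h y) + ∫ τ in Ioc 0 t₂, F τ) - ((∫ y, θ₀ y * h y) + ∫ τ in Ioc 0 t₁, F τ) = ∫ τ in t₁..t₂, F τ := by
    rw [← intervalIntegral.integral_of_le (ht₁.trans ht), ← intervalIntegral.integral_of_le ht₁,
      ← intervalIntegral.integral_add_adjacent_intervals h1 h2]
    ring
  rw [e]
  exact intervalIntegral.abs_integral_le_integral_abs ht

/-! ## The dissipation rate and `(H1)` -/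

/-- **Finite dissipation and the sourced energy inequality in real form**: for every `T > 0`,
`∫⁻_{(0,T)} ‖∇θ‖² < ∞` and `κ (∫⁻_{(0,T)} ‖∇θ‖²).toReal ≤ ½∫θ₀² + ∫_{(0,T)} P`.
[cite: DEIJ2022, (1.2)–(1.3)] -/
theorem lintegral_eScalarGradNormSq_lt_top_and_le (hκ : 0 < κ)
    (hθ : IsWeakScalarTransportForced κ u (fun _ => h) θ₀ θ) (hθ₀ : MemLp θ₀ 2 volume)
    (hh : FunctionSpaces.Torus.IsSmooth h)
    (hG : ∀ T, 0 < T → ∫⁻ t in Ioo 0 T, FunctionSpaces.Torus.eGradNormSq (u t) ^ (1 / 2 : ℝ) < ⊤)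
    {T : ℝ} (hT : 0 < T) :
    ∫⁻ t in Ioo 0 T, eScalarGradNormSq (θ t) < ⊤ ∧
      κ * (∫⁻ t in Ioo 0 T, eScalarGradNormSq (θ t)).toReal ≤ (1 / 2) * (∫ y, θ₀ y ^ 2) +
        ∫ t in Ioo 0 T, ((∫ y, θ₀ y * h y) + ∫ τ in Ioc 0 t, ((∫ y, θ τ y *
          (⟪u τ y, FunctionSpaces.Torus.gradient h y⟫_ℝ + κ * FunctionSpaces.Torus.laplacian h y)) + ∫ y, h y * h y)) := by
  obtain ⟨hE, hreal⟩ := (hθ T hT).energy_ineq_of_lintegral_eGradNormSq_rpow_lt_top hκ hθ₀ hh (hG T hT)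
  -- replace `∫ θ h` by the trace a.e.
  have htr : ∫ t in Ioo 0 T, ∫ x, θ t x * h x = ∫ t in Ioo 0 T, ((∫ y, θ₀ y * h y) + ∫ τ in Ioc 0 t, ((∫ y, θ τ y *
      (⟪u τ y, FunctionSpaces.Torus.gradient h y⟫_ℝ + κ * FunctionSpaces.Torus.laplacian h y)) + ∫ y, h y * h y)) :=
    integral_congr_ae (ae_restrict_of_ae_restrict_of_subset Ioo_subset_Ioi_self (ae_integral_mul_eq_trace hθ hh))
  rw [htr] at hE hreal
  set R : ℝ := (∫ x, θ₀ x ^ 2) + 2 * ∫ t in Ioo 0 T, ((∫ y, θ₀ y * h y) + ∫ τ in Ioc 0 t, ((∫ y, θ τ y *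
      (⟪u τ y, FunctionSpaces.Torus.gradient h y⟫_ℝ + κ * FunctionSpaces.Torus.laplacian h y)) + ∫ y, h y * h y)) with hR
  have hdis : eScalarDissipation κ θ 0 T ≤ ENNReal.ofReal (R / 2) := by
    have e2 : ENNReal.ofReal R = 2 * ENNReal.ofReal (R / 2) := by
      rw [← ENNReal.ofReal_ofNat 2, ← ENNReal.ofReal_mul zero_le_two]
      congr 1; ring
    rw [e2] at hE
    exact (ENNReal.mul_le_mul_iff_right two_ne_zero ENNReal.ofNat_ne_top).1 hE
  have hfin : ∫⁻ t in Ioo 0 T, eScalarGradNormSq (θ t) < ⊤ := by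
    have h1 : eScalarDissipation κ θ 0 T < ⊤ := hdis.trans_lt ENNReal.ofReal_lt_top
    rw [eScalarDissipation] at h1
    rcases ENNReal.mul_lt_top_iff.1 h1 with ⟨-, hX⟩ | h0 | h0
    · exact hX
    · exact absurd h0 (ENNReal.ofReal_pos.2 hκ).ne'
    · rw [h0]; exact ENNReal.zero_lt_top
  refine ⟨hfin, ?_⟩
  have h3 : ENNReal.ofReal κ * ∫⁻ t in Ioo 0 T, eScalarGradNormSq (θ t) ≤ ENNReal.ofReal (R / 2) := hdis
  have h4 := ENNReal.toReal_mono ENNReal.ofReal_ne_top h3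
  rw [ENNReal.toReal_mul, ENNReal.toReal_ofReal hκ.le, ENNReal.toReal_ofReal (by linarith)] at h4
  simp only [hR] at h4
  linarith

/-- **The dissipation rate is integrable on every `(0, T]`** and its interval integral is the
real form of the cumulative dissipation. [folklore] -/
theorem integrableOn_dissipationRate (hκ : 0 < κ)
    (hθ : IsWeakScalarTransportForced κ u (fun _ => h) θ₀ θ) (hθ₀ : MemLp θ₀ 2 volume)
    (hh : FunctionSpaces.Torus.IsSmooth h)
    (hG : ∀ T, 0 < T → ∫⁻ t in Ioo 0 T, FunctionSpaces.Torus.eGradNormSq (u t) ^ (1 / 2 : ℝ) < ⊤)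
    {T : ℝ} (hT : 0 < T) :
    IntegrableOn (fun t => κ * (eScalarGradNormSq (θ t)).toReal) (Ioc 0 T) volume ∧
      ∫ t in (0 : ℝ)..T, κ * (eScalarGradNormSq (θ t)).toReal = κ * (∫⁻ t in Ioo 0 T, eScalarGradNormSq (θ t)).toReal := by
  have hm : AEMeasurable (fun t => eScalarGradNormSq (θ t)) ((volume : Measure ℝ).restrict (Ioo 0 T)) :=
    (hθ T hT).aemeasurable_eScalarGradNormSq
  have hfin := (lintegral_eScalarGradNormSq_lt_top_and_le hκ hθ hθ₀ hh hG hT).1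
  have hi : IntegrableOn (fun t => (eScalarGradNormSq (θ t)).toReal) (Ioo 0 T) volume :=
    integrable_toReal_of_lintegral_ne_top hm hfin.ne
  refine ⟨((integrableOn_Ioc_iff_integrableOn_Ioo (f := fun t => (eScalarGradNormSq (θ t)).toReal)).2 hi).const_mul κ, ?_⟩
  rw [intervalIntegral.integral_of_le hT.le, integral_Ioc_eq_integral_Ioo, MeasureTheory.integral_const_mul,
    integral_toReal hm (ae_lt_top' hm hfin.ne)]

/-- **`(H1)` for the age-decoupling argument**: for every `T > 0`,
`∫₀ᵀ κ‖∇θ‖² ≤ ½∫θ₀² + ∫₀ᵀ P`. [cite: DEIJ2022, (1.2)–(1.3)] -/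
theorem intervalIntegral_dissipationRate_le (hκ : 0 < κ)
    (hθ : IsWeakScalarTransportForced κ u (fun _ => h) θ₀ θ) (hθ₀ : MemLp θ₀ 2 volume)
    (hh : FunctionSpaces.Torus.IsSmooth h)
    (hG : ∀ T, 0 < T → ∫⁻ t in Ioo 0 T, FunctionSpaces.Torus.eGradNormSq (u t) ^ (1 / 2 : ℝ) < ⊤)
    {T : ℝ} (hT : 0 < T) :
    ∫ t in (0 : ℝ)..T, κ * (eScalarGradNormSq (θ t)).toReal ≤ (1 / 2) * (∫ y, θ₀ y ^ 2) +
      ∫ t in (0 : ℝ)..T, ((∫ y, θ₀ y * h y) + ∫ τ in Ioc 0 t, ((∫ y, θ τ y *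
        (⟪u τ y, FunctionSpaces.Torus.gradient h y⟫_ℝ + κ * FunctionSpaces.Torus.laplacian h y)) + ∫ y, h y * h y)) := by
  rw [(integrableOn_dissipationRate hκ hθ hθ₀ hh hG hT).2, intervalIntegral.integral_of_le hT.le, integral_Ioc_eq_integral_Ioo]
  exact (lintegral_eScalarGradNormSq_lt_top_and_le hκ hθ hθ₀ hh hG hT).2

/-! ## The variance: local integrability and `(H3)` -/

/-- `t ↦ ‖θ(t)‖²_{L²} = scalarL2Sq (θ t)` is integrable on every `(0, T]` and bounded a.e. there.
[folklore] -/
theorem integrableOn_scalarL2Sq (hθ : IsWeakScalarTransportForced κ u (fun _ => h) θ₀ θ) {T : ℝ} (hT : 0 < T) :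
    IntegrableOn (fun t => scalarL2Sq (θ t)) (Ioc 0 T) volume ∧
      ∃ C : ℝ, ∀ᵐ t ∂((volume : Measure ℝ).restrict (Ioc 0 T)), scalarL2Sq (θ t) ≤ C := by
  have hW := hθ T hT
  obtain ⟨C, hC⟩ := hW.ae_lintegral_sq_le
  set μT : Measure ℝ := (volume : Measure ℝ).restrict (Ioo 0 T) with hμT
  -- `θ²` is integrable on `(0,T) × T^d`
  have hm : AEStronglyMeasurable (fun p : ℝ × UnitAddTorus d => θ p.1 p.2 ^ 2) (μT.prod volume) :=
    (continuous_pow 2).comp_aestronglyMeasurable hW.aestronglyMeasurable_uncurry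
  have hfin : ∫⁻ p, ‖θ p.1 p.2 ^ 2‖ₑ ∂(μT.prod volume) < ⊤ := by
    rw [lintegral_prod _ hm.enorm]
    have e : ∀ t x, ‖θ t x ^ 2‖ₑ = ‖θ t x‖ₑ ^ 2 := fun t x => by
      rw [Real.enorm_eq_ofReal (sq_nonneg _), Real.enorm_eq_ofReal_abs, ← ENNReal.ofReal_pow (abs_nonneg _), sq_abs]
    simp_rw [e]
    calc ∫⁻ t, ∫⁻ x, ‖θ t x‖ₑ ^ 2 ∂volume ∂μT ≤ ∫⁻ _, (C : ℝ≥0∞) ∂μT := lintegral_mono_ae hC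
      _ < ⊤ := by rw [lintegral_const]; exact ENNReal.mul_lt_top ENNReal.coe_lt_top (measure_lt_top _ _)
  have hi : Integrable (fun p : ℝ × UnitAddTorus d => θ p.1 p.2 ^ 2) (μT.prod volume) := ⟨hm, hfin⟩
  have h1 : IntegrableOn (fun t => scalarL2Sq (θ t)) (Ioo 0 T) volume := hi.integral_prod_left
  refine ⟨(integrableOn_Ioc_iff_integrableOn_Ioo (f := fun t => scalarL2Sq (θ t))).2 h1, (C : ℝ), ?_⟩
  rw [← Measure.restrict_congr_set (Ioo_ae_eq_Ioc (a := (0 : ℝ)) (b := T))]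
  filter_upwards [hC, hW.ae_memLp_two] with t ht hm2
  have e : ENNReal.ofReal (scalarL2Sq (θ t)) = ∫⁻ x, ‖θ t x‖ₑ ^ 2 := by
    rw [scalarL2Sq, ofReal_integral_eq_lintegral_ofReal hm2.integrable_sq (ae_of_all _ fun x => sq_nonneg _)]
    refine lintegral_congr fun x => ?_
    rw [Real.enorm_eq_ofReal_abs, ← ENNReal.ofReal_pow (abs_nonneg _), sq_abs]
  have h2 : ENNReal.ofReal (scalarL2Sq (θ t)) ≤ C := e ▸ ht
  exact (ENNReal.ofReal_le_iff_le_toReal ENNReal.coe_ne_top).1 h2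

/-- **`(H3)` for the age-decoupling argument**: for a.e. `t > 0`, `P(t)² ≤ (∫ h²) ‖θ(t)‖²`
(the trace is `∫ θ(t) h` a.e.; Cauchy–Schwarz). [folklore] -/
theorem ae_trace_sq_le (hθ : IsWeakScalarTransportForced κ u (fun _ => h) θ₀ θ)
    (hh : FunctionSpaces.Torus.IsSmooth h) :
    ∀ᵐ t ∂((volume : Measure ℝ).restrict (Ioi 0)),
      ((∫ y, θ₀ y * h y) + ∫ τ in Ioc 0 t, ((∫ y, θ τ y *
        (⟪u τ y, FunctionSpaces.Torus.gradient h y⟫_ℝ + κ * FunctionSpaces.Torus.laplacian h y)) + ∫ y, h y * h y)) ^ 2 ≤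
        (∫ y, h y ^ 2) * scalarL2Sq (θ t) := by
  have hmem : ∀ᵐ t ∂((volume : Measure ℝ).restrict (Ioi 0)), MemLp (θ t) 2 volume := by
    rw [Ioi_zero_eq_iUnion_Ioo_nat, ae_restrict_iUnion_iff]
    intro n
    rcases Nat.eq_zero_or_pos n with hn | hn
    · subst hn; simp
    · exact (hθ n (by exact_mod_cast hn)).ae_memLp_two
  filter_upwards [ae_integral_mul_eq_trace hθ hh, hmem] with t ht hm2
  rw [← ht]
  have hcs := DEIJ.abs_integral_mul_le_sqrt hm2 (hh.memLp 2)
  have h1 : (∫ y, θ t y * h y) ^ 2 = |∫ y, θ t y * h y| ^ 2 := (sq_abs _).symm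
  rw [h1]
  calc |∫ y, θ t y * h y| ^ 2 ≤ (Real.sqrt (∫ y, θ t y ^ 2) * Real.sqrt (∫ y, h y ^ 2)) ^ 2 :=
        pow_le_pow_left₀ (abs_nonneg _) hcs 2
    _ = (∫ y, h y ^ 2) * scalarL2Sq (θ t) := by
        rw [mul_pow, Real.sq_sqrt (integral_nonneg fun _ => sq_nonneg _),
          Real.sq_sqrt (integral_nonneg fun _ => sq_nonneg _), scalarL2Sq, mul_comm]


/-! ## Poincaré with mean conservation: the variance in terms of the dissipation rate -/

/-- **Mean conservation and Poincaré**: for a mean-zero source, for a.e. `t ∈ (0,T)`,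
`‖θ(t)‖² ≤ (∫θ₀)² + (4π²κ)⁻¹ · κ‖∇θ(t)‖²` (`∫ θ(t) = ∫ θ₀` and `4π² Var θ(t) ≤ ‖∇θ(t)‖²`).
[cite: DEIJ2022, §1 (1.1)] -/
theorem ae_scalarL2Sq_le (hκ : 0 < κ) (hθ : IsWeakScalarTransportForced κ u (fun _ => h) θ₀ θ)
    (hθ₀ : MemLp θ₀ 2 volume) (hh : FunctionSpaces.Torus.IsSmooth h) (hh0 : FunctionSpaces.Torus.HasZeroMean h)
    (hG : ∀ T, 0 < T → ∫⁻ t in Ioo 0 T, FunctionSpaces.Torus.eGradNormSq (u t) ^ (1 / 2 : ℝ) < ⊤)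
    {T : ℝ} (hT : 0 < T) :
    ∀ᵐ t ∂((volume : Measure ℝ).restrict (Ioo 0 T)),
      scalarL2Sq (θ t) ≤ (∫ y, θ₀ y) ^ 2 + (4 * Real.pi ^ 2 * κ)⁻¹ * (κ * (eScalarGradNormSq (θ t)).toReal) ∧
      ((∫ y, θ₀ y * h y) + ∫ τ in Ioc 0 t, ((∫ y, θ τ y *
        (⟪u τ y, FunctionSpaces.Torus.gradient h y⟫_ℝ + κ * FunctionSpaces.Torus.laplacian h y)) + ∫ y, h y * h y)) ^ 2 ≤
        (∫ y, h y ^ 2) * ((4 * Real.pi ^ 2 * κ)⁻¹ * (κ * (eScalarGradNormSq (θ t)).toReal)) := by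
  have hW := hθ T hT
  have hm : AEMeasurable (fun t => eScalarGradNormSq (θ t)) ((volume : Measure ℝ).restrict (Ioo 0 T)) :=
    hW.aemeasurable_eScalarGradNormSq
  have hfin := (lintegral_eScalarGradNormSq_lt_top_and_le hκ hθ hθ₀ hh hG hT).1
  have hπ : 0 < 4 * Real.pi ^ 2 * κ := by positivity
  filter_upwards [hW.ae_memLp_two, ae_lt_top' hm hfin.ne, hW.ae_integral_eq,
    ae_restrict_of_ae_restrict_of_subset Ioo_subset_Ioi_self (ae_integral_mul_eq_trace hθ hh)] with t hm2 htop hmean htr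
  -- mean conservation
  have hmean' : ∫ y, θ t y = ∫ y, θ₀ y := by
    rw [hmean]
    have : ∫ τ in Ioc 0 t, ∫ x, (fun _ : ℝ => h) τ x = 0 := by
      simp only [show (∫ x, h x) = 0 from hh0, integral_zero]
    rw [this, add_zero]
  -- Poincaré
  have hP := scalarVariance_le_toReal_eScalarGradNormSq hm2 htop.ne
  rw [hmean'] at hP
  have h1 : scalarL2Sq (θ t) ≤ (∫ y, θ₀ y) ^ 2 + (4 * Real.pi ^ 2 * κ)⁻¹ * (κ * (eScalarGradNormSq (θ t)).toReal) := by
    rw [scalarL2Sq]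
    have e : (4 * Real.pi ^ 2 * κ)⁻¹ * (κ * (eScalarGradNormSq (θ t)).toReal) = (4 * Real.pi ^ 2)⁻¹ * (eScalarGradNormSq (θ t)).toReal := by
      field_simp
    rw [e]
    have h4 : 0 < 4 * Real.pi ^ 2 := by positivity
    have h5 : (∫ x, θ t x ^ 2) - (∫ y, θ₀ y) ^ 2 ≤ (4 * Real.pi ^ 2)⁻¹ * (eScalarGradNormSq (θ t)).toReal := by
      rw [← div_eq_inv_mul, le_div_iff₀' h4]; exact hP
    linarith
  refine ⟨h1, ?_⟩
  -- the trace against the mean-zero `h`: Cauchy–Schwarz with `θ - ∫θ₀`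
  rw [← htr]
  set m : ℝ := ∫ y, θ₀ y with hm_def
  have hint : Integrable (θ t) volume := hm2.integrable one_le_two
  obtain ⟨Ch, hCh⟩ := FunctionSpaces.Torus.exists_forall_norm_le_of_continuous hh.continuous
  have hhi : Integrable h volume := hh.continuous.integrable_unitAddTorus
  have i1 : Integrable (fun y => θ t y * h y) volume :=
    hint.mul_bdd hh.continuous.aestronglyMeasurable (Eventually.of_forall hCh)
  have i2 : Integrable (fun y => m * h y) volume := hhi.const_mul m
  have e1 : ∫ y, θ t y * h y = ∫ y, (θ t y - m) * h y := by
    have e2 : (fun y => (θ t y - m) * h y) = fun y => θ t y * h y - m * h y := by funext y; ring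
    rw [e2, integral_sub i1 i2, MeasureTheory.integral_const_mul, show (∫ y, h y) = 0 from hh0, mul_zero, sub_zero]
  have hvar : ∫ y, (θ t y - m) ^ 2 = (∫ y, θ t y ^ 2) - m ^ 2 := by
    have e3 : (fun y => (θ t y - m) ^ 2) = fun y => θ t y ^ 2 - (2 * m) * θ t y + m ^ 2 := by funext y; ring
    have j1 : Integrable (fun y => θ t y ^ 2) volume := hm2.integrable_sq
    have j2 : Integrable (fun y => (2 * m) * θ t y) volume := hint.const_mul _
    have j3 : Integrable (fun _ : UnitAddTorus d => m ^ 2) volume := integrable_const _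
    have j12 : Integrable (fun y => θ t y ^ 2 - (2 * m) * θ t y) volume := j1.sub j2
    rw [e3, integral_add j12 j3, integral_sub j1 j2, MeasureTheory.integral_const_mul, hmean', integral_const]
    simp only [probReal_univ, smul_eq_mul, one_mul]
    ring
  have hcs := DEIJ.abs_integral_mul_le_sqrt (hm2.sub (memLp_const m)) (hh.memLp 2)
  have hv0 : 0 ≤ ∫ y, (θ t y - m) ^ 2 := integral_nonneg fun _ => sq_nonneg _
  have hH0 : 0 ≤ ∫ y, h y ^ 2 := integral_nonneg fun _ => sq_nonneg _
  have hX : ∫ y, (θ t y - m) ^ 2 ≤ (4 * Real.pi ^ 2 * κ)⁻¹ * (κ * (eScalarGradNormSq (θ t)).toReal) := by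
    rw [hvar]; rw [scalarL2Sq] at h1; linarith
  rw [e1]
  have h5 : (∫ y, (θ t y - m) * h y) ^ 2 ≤ (∫ y, (θ t y - m) ^ 2) * ∫ y, h y ^ 2 := by
    have h6 : |∫ y, (θ t y - m) * h y| ^ 2 ≤ (Real.sqrt (∫ y, (θ t y - m) ^ 2) * Real.sqrt (∫ y, h y ^ 2)) ^ 2 :=
      pow_le_pow_left₀ (abs_nonneg _) (by simpa only [Pi.sub_apply] using hcs) 2
    rw [sq_abs, mul_pow, Real.sq_sqrt hv0, Real.sq_sqrt hH0] at h6
    exact h6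
  calc (∫ y, (θ t y - m) * h y) ^ 2 ≤ (∫ y, (θ t y - m) ^ 2) * ∫ y, h y ^ 2 := h5
    _ ≤ ((4 * Real.pi ^ 2 * κ)⁻¹ * (κ * (eScalarGradNormSq (θ t)).toReal)) * ∫ y, h y ^ 2 :=
        mul_le_mul_of_nonneg_right hX hH0
    _ = (∫ y, h y ^ 2) * ((4 * Real.pi ^ 2 * κ)⁻¹ * (κ * (eScalarGradNormSq (θ t)).toReal)) := mul_comm _ _


/-! ## Honest running means of the variance -/

/-- **The running means of `‖θ‖²` are eventually bounded** (`ν > 0` damps the variance, the mean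
is conserved): from Poincaré with mean conservation, `(H1)` and `P ≤ (H₂c + q)/2`,
`∫_{(0,T]} ‖θ‖² ≤ A + B T`. [cite: DoeringFoias2002, §2] -/
theorem isBoundedUnder_timeMean_scalarL2Sq (hκ : 0 < κ) (hθ : IsWeakScalarTransportForced κ u (fun _ => h) θ₀ θ)
    (hθ₀ : MemLp θ₀ 2 volume) (hh : FunctionSpaces.Torus.IsSmooth h) (hh0 : FunctionSpaces.Torus.HasZeroMean h)
    (hG : ∀ T, 0 < T → ∫⁻ t in Ioo 0 T, FunctionSpaces.Torus.eGradNormSq (u t) ^ (1 / 2 : ℝ) < ⊤) :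
    IsBoundedUnder (· ≤ ·) atTop (timeMean fun t => scalarL2Sq (θ t)) := by
  set c : ℝ := (4 * Real.pi ^ 2 * κ)⁻¹ with hc
  set m : ℝ := ∫ y, θ₀ y with hm
  set H₂ : ℝ := ∫ y, h y ^ 2 with hH₂
  set C₀ : ℝ := (1 / 2) * ∫ y, θ₀ y ^ 2 with hC₀
  have hc0 : 0 ≤ c := by positivity
  have hH0 : 0 ≤ H₂ := integral_nonneg fun _ => sq_nonneg _
  refine isBoundedUnder_timeMean_of_setIntegral_le_linear (A := c * (2 * C₀)) (B := m ^ 2 + c * (H₂ * c)) fun T hT => ?_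
  set P : ℝ → ℝ := fun t => (∫ y, θ₀ y * h y) + ∫ τ in Ioc 0 t, ((∫ y, θ τ y *
    (⟪u τ y, FunctionSpaces.Torus.gradient h y⟫_ℝ + κ * FunctionSpaces.Torus.laplacian h y)) + ∫ y, h y * h y) with hP
  set q : ℝ → ℝ := fun t => κ * (eScalarGradNormSq (θ t)).toReal with hq
  have hq0 : ∀ t, 0 ≤ q t := fun t => mul_nonneg hκ.le ENNReal.toReal_nonneg
  -- integrability on `(0, T]`
  obtain ⟨hei, -⟩ := integrableOn_scalarL2Sq hθ hT
  have hqi : IntegrableOn q (Ioc 0 T) volume := (integrableOn_dissipationRate hκ hθ hθ₀ hh hG hT).1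
  have hPi : IntegrableOn P (Ioc 0 T) volume :=
    ((continuousOn_trace hθ hh T).integrableOn_Icc).mono_set Ioc_subset_Icc_self
  -- the a.e. bounds, on `(0, T]`
  have hae : ∀ᵐ t ∂((volume : Measure ℝ).restrict (Ioc 0 T)),
      scalarL2Sq (θ t) ≤ m ^ 2 + c * q t ∧ P t ≤ (H₂ * c + q t) / 2 := by
    rw [← Measure.restrict_congr_set (Ioo_ae_eq_Ioc (a := (0 : ℝ)) (b := T))]
    filter_upwards [ae_scalarL2Sq_le hκ hθ hθ₀ hh hh0 hG hT] with t ht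
    refine ⟨ht.1, ?_⟩
    have h1 : P t ^ 2 ≤ ((H₂ * c + q t) / 2) ^ 2 := by
      have := ht.2
      nlinarith [sq_nonneg (H₂ * c - q t)]
    have h2 : 0 ≤ (H₂ * c + q t) / 2 := by have := hq0 t; positivity
    exact (le_abs_self _).trans ((pow_le_pow_iff_left₀ (abs_nonneg (P t)) h2 two_ne_zero).1 (by rwa [sq_abs]))
  -- `∫ q ≤ 2C₀ + H₂ c T`
  have hH1 := intervalIntegral_dissipationRate_le hκ hθ hθ₀ hh hG hT
  rw [intervalIntegral.integral_of_le hT.le, intervalIntegral.integral_of_le hT.le] at hH1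
  have iK : Integrable (fun _ : ℝ => H₂ * c) ((volume : Measure ℝ).restrict (Ioc 0 T)) := integrable_const _
  have iKq : Integrable (fun t => H₂ * c + q t) ((volume : Measure ℝ).restrict (Ioc 0 T)) := iK.add hqi
  have hPint : ∫ t in Ioc 0 T, P t ≤ ∫ t in Ioc 0 T, (H₂ * c + q t) / 2 :=
    integral_mono_ae hPi (iKq.div_const 2) (hae.mono fun t ht => ht.2)
  have e1 : ∫ t in Ioc 0 T, (H₂ * c + q t) / 2 = (H₂ * c * T + ∫ t in Ioc 0 T, q t) / 2 := by
    rw [integral_div, integral_add iK hqi, setIntegral_const]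
    simp only [smul_eq_mul, Real.volume_real_Ioc_of_le hT.le, sub_zero]
    ring
  have hQ : ∫ t in Ioc 0 T, q t ≤ 2 * C₀ + H₂ * c * T := by
    have : ∫ t in Ioc 0 T, q t ≤ C₀ + (H₂ * c * T + ∫ t in Ioc 0 T, q t) / 2 := by
      simp only [hC₀]; linarith [hH1, hPint, e1]
    linarith
  -- `∫ e ≤ m² T + c ∫ q`
  have iM : Integrable (fun _ : ℝ => m ^ 2) ((volume : Measure ℝ).restrict (Ioc 0 T)) := integrable_const _
  have icq : Integrable (fun t => c * q t) ((volume : Measure ℝ).restrict (Ioc 0 T)) := hqi.const_mul c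
  have hE : ∫ t in Ioc 0 T, scalarL2Sq (θ t) ≤ ∫ t in Ioc 0 T, (m ^ 2 + c * q t) :=
    integral_mono_ae hei (iM.add icq) (hae.mono fun t ht => ht.1)
  have e2 : ∫ t in Ioc 0 T, (m ^ 2 + c * q t) = m ^ 2 * T + c * ∫ t in Ioc 0 T, q t := by
    rw [integral_add iM icq, setIntegral_const, MeasureTheory.integral_const_mul]
    simp only [smul_eq_mul, Real.volume_real_Ioc_of_le hT.le, sub_zero]
    ring
  calc ∫ t in Ioc 0 T, scalarL2Sq (θ t) ≤ m ^ 2 * T + c * ∫ t in Ioc 0 T, q t := hE.trans_eq e2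
    _ ≤ m ^ 2 * T + c * (2 * C₀ + H₂ * c * T) := by gcongr
    _ = c * (2 * C₀) + (m ^ 2 + c * (H₂ * c)) * T := by ring

/-! ## The viscous ceiling of the mean dissipation -/

/-- **The mean dissipation is at most `O(‖h‖²/κ)`** for every steadily sourced weak scalar with a
mean-zero source: `⟨κ‖∇θ‖²⟩ ≤ (∫h²)/κ` (from `(H1)`, `P ≤ (H₂ q/(4π²κ))^{1/2}` and Jensen in
time, absorbing the square root; the mean is conserved and Poincaré damps the rest).
[cite: DoeringFoias2002, §2] -/
theorem longTimeAvgSup_dissipationRate_le (hκ : 0 < κ) (hθ : IsWeakScalarTransportForced κ u (fun _ => h) θ₀ θ)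
    (hθ₀ : MemLp θ₀ 2 volume) (hh : FunctionSpaces.Torus.IsSmooth h) (hh0 : FunctionSpaces.Torus.HasZeroMean h)
    (hG : ∀ T, 0 < T → ∫⁻ t in Ioo 0 T, FunctionSpaces.Torus.eGradNormSq (u t) ^ (1 / 2 : ℝ) < ⊤) :
    longTimeAvgSup (fun t => κ * (eScalarGradNormSq (θ t)).toReal) ≤ (∫ y, h y ^ 2) / κ := by
  set c : ℝ := (4 * Real.pi ^ 2 * κ)⁻¹ with hc
  set H₂ : ℝ := ∫ y, h y ^ 2 with hH₂
  set C₀ : ℝ := (1 / 2) * ∫ y, θ₀ y ^ 2 with hC₀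
  set q : ℝ → ℝ := fun t => κ * (eScalarGradNormSq (θ t)).toReal with hq
  set dd : ℝ := H₂ * c / 4 with hdd
  have hc0 : 0 ≤ c := by positivity
  have hH0 : 0 ≤ H₂ := integral_nonneg fun _ => sq_nonneg _
  have hdd0 : 0 ≤ dd := by positivity
  have hq0 : ∀ t, 0 ≤ q t := fun t => mul_nonneg hκ.le ENNReal.toReal_nonneg
  -- the finite-`T` inequality `x_T ≤ C₀/T + √(H₂ c x_T)`
  have hmain : ∀ T, 0 < T → timeMean q T ≤ C₀ / T + 2 * Real.sqrt (1 * timeMean q T * dd) + 1 * dd := by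
    intro T hT
    set P : ℝ → ℝ := fun t => (∫ y, θ₀ y * h y) + ∫ τ in Ioc 0 t, ((∫ y, θ τ y *
      (⟪u τ y, FunctionSpaces.Torus.gradient h y⟫_ℝ + κ * FunctionSpaces.Torus.laplacian h y)) + ∫ y, h y * h y) with hP
    have hqi : IntegrableOn q (Ioc 0 T) volume := (integrableOn_dissipationRate hκ hθ hθ₀ hh hG hT).1
    have hPi : IntegrableOn P (Ioc 0 T) volume :=
      ((continuousOn_trace hθ hh T).integrableOn_Icc).mono_set Ioc_subset_Icc_self
    -- `P ≤ √(H₂ c q)` a.e.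
    have hae : ∀ᵐ t ∂((volume : Measure ℝ).restrict (Ioc 0 T)), P t ≤ Real.sqrt (H₂ * c * q t) := by
      rw [← Measure.restrict_congr_set (Ioo_ae_eq_Ioc (a := (0 : ℝ)) (b := T))]
      filter_upwards [ae_scalarL2Sq_le hκ hθ hθ₀ hh hh0 hG hT] with t ht
      have h1 : P t ^ 2 ≤ H₂ * c * q t := by
        have e : H₂ * c * q t = (∫ y, h y ^ 2) * ((4 * Real.pi ^ 2 * κ)⁻¹ * (κ * (eScalarGradNormSq (θ t)).toReal)) := by
          simp only [hH₂, hc, hq]; ring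
        rw [e]; exact ht.2
      calc P t ≤ |P t| := le_abs_self _
        _ = Real.sqrt (P t ^ 2) := (Real.sqrt_sq_eq_abs _).symm
        _ ≤ Real.sqrt (H₂ * c * q t) := Real.sqrt_le_sqrt h1
    -- integrability of `√(H₂ c q)`
    have i1 : Integrable (fun _ : ℝ => (1 : ℝ)) ((volume : Measure ℝ).restrict (Ioc 0 T)) := integrable_const _
    have ib : Integrable (fun t => 1 + H₂ * c * q t) ((volume : Measure ℝ).restrict (Ioc 0 T)) :=
      i1.add (hqi.const_mul (H₂ * c))
    have hsq_i : IntegrableOn (fun t => Real.sqrt (H₂ * c * q t)) (Ioc 0 T) volume := by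
      refine Integrable.mono' ib
        (Real.continuous_sqrt.comp_aestronglyMeasurable (hqi.const_mul (H₂ * c)).aestronglyMeasurable)
        (Eventually.of_forall fun t => ?_)
      rw [Real.norm_eq_abs, abs_of_nonneg (Real.sqrt_nonneg _)]
      show Real.sqrt (H₂ * c * q t) ≤ 1 + H₂ * c * q t
      have h0 : 0 ≤ H₂ * c * q t := by have := hq0 t; positivity
      nlinarith [Real.sq_sqrt h0, Real.sqrt_nonneg (H₂ * c * q t), sq_nonneg (Real.sqrt (H₂ * c * q t) - 1)]
    -- `timeMean P ≤ timeMean √(H₂ c q) ≤ √(H₂ c · timeMean q)`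
    have h1 : timeMean P T ≤ timeMean (fun t => Real.sqrt (H₂ * c * q t)) T := by
      unfold timeMean
      rw [intervalIntegral.integral_of_le hT.le, intervalIntegral.integral_of_le hT.le]
      exact mul_le_mul_of_nonneg_left (integral_mono_ae hPi hsq_i hae) (inv_nonneg.2 hT.le)
    have h2 : timeMean (fun t => Real.sqrt (H₂ * c * q t)) T ≤ Real.sqrt (timeMean (fun t => H₂ * c * q t) T) :=
      timeMean_sqrt_le_sqrt_timeMean hT (fun t => by have := hq0 t; positivity) (hqi.const_mul (H₂ * c))
    rw [timeMean_const_mul] at h2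
    -- `(H1)` divided by `T`
    have hH1 := intervalIntegral_dissipationRate_le hκ hθ hθ₀ hh hG hT
    have h3 : timeMean q T ≤ C₀ / T + timeMean P T := by
      unfold timeMean
      have := mul_le_mul_of_nonneg_left hH1 (inv_nonneg.2 hT.le)
      rw [mul_add] at this
      have e : T⁻¹ * ((1 / 2) * ∫ y, θ₀ y ^ 2) = C₀ / T := by rw [hC₀]; field_simp
      linarith [this, e.symm.le, e.le]
    have h4 : Real.sqrt (H₂ * c * timeMean q T) = 2 * Real.sqrt (1 * timeMean q T * dd) := by
      rw [show H₂ * c * timeMean q T = 2 ^ 2 * (1 * timeMean q T * dd) by rw [hdd]; ring,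
        Real.sqrt_mul (by norm_num), Real.sqrt_sq (by norm_num)]
    linarith [h1, h2, h3, h4, hdd0]
  -- absorb the square root in the `limsup`
  have hlim := AgeDecoupling.limsup_le_sq_of_eventually_le (l := atTop) (x := timeMean q) (a := fun T => C₀ / T)
    (d := fun _ => dd) (A := 0) (D := dd) (S := 1) zero_le_one
    ((eventually_ge_atTop (0 : ℝ)).mono fun T hT => timeMean_nonneg hq0 hT)
    (Eventually.of_forall fun _ => hdd0)
    (fun ε hε => by
      have h0 : Tendsto (fun T : ℝ => C₀ / T) atTop (𝓝 0) := by
        simpa using tendsto_const_nhds.div_atTop tendsto_id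
      filter_upwards [h0.eventually (gt_mem_nhds (show (0 : ℝ) < 0 + ε by linarith))] with T hT using hT.le)
    (fun ε hε => Eventually.of_forall fun _ => by linarith)
    ((eventually_gt_atTop (0 : ℝ)).mono fun T hT => hmain T hT)
  refine hlim.trans ?_
  -- `(√dd + √(2dd))² = dd (1 + √2)² ≤ 6 dd ≤ H₂/κ`
  have e1 : (Real.sqrt (1 * dd) + Real.sqrt (0 + 2 * 1 * dd)) ^ 2 = dd * (1 + Real.sqrt 2) ^ 2 := by
    rw [one_mul, zero_add, mul_one, Real.sqrt_mul (by norm_num : (0 : ℝ) ≤ 2) dd]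
    calc (Real.sqrt dd + Real.sqrt 2 * Real.sqrt dd) ^ 2 = Real.sqrt dd ^ 2 * (1 + Real.sqrt 2) ^ 2 := by ring
      _ = dd * (1 + Real.sqrt 2) ^ 2 := by rw [Real.sq_sqrt hdd0]
  rw [e1]
  have h2 : (1 + Real.sqrt 2) ^ 2 ≤ 6 := by
    nlinarith [Real.sq_sqrt (show (0:ℝ) ≤ 2 by norm_num), Real.sqrt_nonneg 2,
      Real.sqrt_le_sqrt (show (2:ℝ) ≤ 4 by norm_num), show Real.sqrt 4 = 2 by
        rw [show (4:ℝ) = 2 ^ 2 by norm_num, Real.sqrt_sq (by norm_num)]]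
  have hπ : 6 * (4 * Real.pi ^ 2)⁻¹ / 4 ≤ 1 := by
    rw [div_le_one (by norm_num)]
    have : (1 : ℝ) ≤ Real.pi ^ 2 := by nlinarith [Real.pi_gt_three]
    rw [← div_eq_mul_inv, div_le_iff₀ (by positivity)]
    nlinarith
  calc dd * (1 + Real.sqrt 2) ^ 2 ≤ dd * 6 := mul_le_mul_of_nonneg_left h2 hdd0
    _ = H₂ / κ * (6 * (4 * Real.pi ^ 2)⁻¹ / 4) := by rw [hdd, hc]; field_simp
    _ ≤ H₂ / κ * 1 := mul_le_mul_of_nonneg_left hπ (div_nonneg hH0 hκ.le)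
    _ = (∫ y, h y ^ 2) / κ := by rw [mul_one]


/-! ## Windows of the dissipation rate and the size of the trace integrand -/

/-- **The dissipation over a window**: for `0 ≤ a ≤ b`, `∫⁻_{(a,b)} ‖∇θ‖² < ∞` and
`∫ₐᵇ κ‖∇θ‖² = κ (∫⁻_{(a,b)} ‖∇θ‖²).toReal`. [folklore] -/
theorem intervalIntegral_dissipationRate_eq (hκ : 0 < κ)
    (hθ : IsWeakScalarTransportForced κ u (fun _ => h) θ₀ θ) (hθ₀ : MemLp θ₀ 2 volume)
    (hh : FunctionSpaces.Torus.IsSmooth h)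
    (hG : ∀ T, 0 < T → ∫⁻ t in Ioo 0 T, FunctionSpaces.Torus.eGradNormSq (u t) ^ (1 / 2 : ℝ) < ⊤)
    {a b : ℝ} (ha : 0 ≤ a) (hab : a ≤ b) :
    ∫⁻ t in Ioo a b, eScalarGradNormSq (θ t) < ⊤ ∧
      ∫ t in a..b, κ * (eScalarGradNormSq (θ t)).toReal = κ * (∫⁻ t in Ioo a b, eScalarGradNormSq (θ t)).toReal := by
  have hT : 0 < b + 1 := by linarith
  have hsub : Ioo a b ⊆ Ioo 0 (b + 1) := Ioo_subset_Ioo ha (by linarith)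
  have hm : AEMeasurable (fun t => eScalarGradNormSq (θ t)) ((volume : Measure ℝ).restrict (Ioo a b)) :=
    ((hθ _ hT).aemeasurable_eScalarGradNormSq).mono_measure (Measure.restrict_mono hsub le_rfl)
  have hfin : ∫⁻ t in Ioo a b, eScalarGradNormSq (θ t) < ⊤ :=
    lt_of_le_of_lt (lintegral_mono_set hsub) (lintegral_eScalarGradNormSq_lt_top_and_le hκ hθ hθ₀ hh hG hT).1
  refine ⟨hfin, ?_⟩
  rw [intervalIntegral.integral_of_le hab, integral_Ioc_eq_integral_Ioo, MeasureTheory.integral_const_mul,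
    integral_toReal hm (ae_lt_top' hm hfin.ne)]

/-- **Size of the trace integrand**: for `κ ≥ 0` and a.e. `r > 0`,
`|∫ θ(r)(⟪u(r), ∇h⟫ + κΔh) + ∫ h²| ≤ C_∇ (‖θ(r)‖² + ‖u(r)‖²)/2 + κ C_Δ (1 + ‖θ(r)‖²)/2 + ∫ h²`
(`|θ||u| ≤ (θ² + |u|²)/2`, `|θ| ≤ (1 + θ²)/2`). [folklore] -/
theorem ae_abs_traceDeriv_le (hκ : 0 ≤ κ) (hθ : IsWeakScalarTransportForced κ u (fun _ => h) θ₀ θ)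
    {Cg Cl : ℝ} (hCg : ∀ x, ‖FunctionSpaces.Torus.gradient h x‖ ≤ Cg)
    (hCl : ∀ x, |FunctionSpaces.Torus.laplacian h x| ≤ Cl) :
    ∀ᵐ r ∂((volume : Measure ℝ).restrict (Ioi 0)),
      |(∫ y, θ r y * (⟪u r y, FunctionSpaces.Torus.gradient h y⟫_ℝ + κ * FunctionSpaces.Torus.laplacian h y)) + ∫ y, h y * h y| ≤
        Cg * (scalarL2Sq (θ r) + ∫ y, ‖u r y‖ ^ 2) / 2 + κ * Cl * (1 + scalarL2Sq (θ r)) / 2 + ∫ y, h y ^ 2 := by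
  have hCg0 : 0 ≤ Cg := (norm_nonneg _).trans (hCg 0)
  have hCl0 : 0 ≤ Cl := (abs_nonneg _).trans (hCl 0)
  rw [Ioi_zero_eq_iUnion_Ioo_nat, ae_restrict_iUnion_iff]
  intro n
  rcases Nat.eq_zero_or_pos n with hn | hn
  · subst hn; simp
  have hW := hθ n (by exact_mod_cast hn)
  filter_upwards [hW.ae_memLp_two, hW.ae_slice_integrable₁, hW.ae_memLp_two_velocity] with r hm2 hsl hvL2
  obtain ⟨hθi, -, hvθ, -⟩ := hsl
  have hv2 : Integrable (fun y => ‖u r y‖ ^ 2) volume := (memLp_two_iff_integrable_sq_norm hvL2.1).1 hvL2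
  have hθ2 : Integrable (fun y => θ r y ^ 2) volume := hm2.integrable_sq
  have hav' : Integrable (fun y => ‖u r y‖ * |θ r y|) volume := by
    refine hvθ.norm.congr (Eventually.of_forall fun y => ?_); simp [Real.norm_eq_abs]
  have hpt : ∀ y, |θ r y * (⟪u r y, FunctionSpaces.Torus.gradient h y⟫_ℝ + κ * FunctionSpaces.Torus.laplacian h y)| ≤
      Cg * (‖u r y‖ * |θ r y|) + κ * Cl * |θ r y| := by
    intro y
    rw [abs_mul]
    have h1 : |⟪u r y, FunctionSpaces.Torus.gradient h y⟫_ℝ| ≤ ‖u r y‖ * Cg :=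
      (abs_real_inner_le_norm _ _).trans (mul_le_mul_of_nonneg_left (hCg y) (norm_nonneg _))
    have h2 : |κ * FunctionSpaces.Torus.laplacian h y| ≤ κ * Cl := by
      rw [abs_mul, abs_of_nonneg hκ]; exact mul_le_mul_of_nonneg_left (hCl y) hκ
    calc |θ r y| * |⟪u r y, FunctionSpaces.Torus.gradient h y⟫_ℝ + κ * FunctionSpaces.Torus.laplacian h y|
        ≤ |θ r y| * (‖u r y‖ * Cg + κ * Cl) :=
          mul_le_mul_of_nonneg_left ((abs_add_le _ _).trans (add_le_add h1 h2)) (abs_nonneg _)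
      _ = Cg * (‖u r y‖ * |θ r y|) + κ * Cl * |θ r y| := by ring
  have i1 : ∫ y, ‖u r y‖ * |θ r y| ≤ (scalarL2Sq (θ r) + ∫ y, ‖u r y‖ ^ 2) / 2 := by
    have h3 : ∫ y, ‖u r y‖ * |θ r y| ≤ ∫ y, (θ r y ^ 2 + ‖u r y‖ ^ 2) / 2 :=
      integral_mono hav' ((hθ2.add hv2).div_const 2) fun y => by
        dsimp only; nlinarith [sq_nonneg (‖u r y‖ - |θ r y|), sq_abs (θ r y)]
    rw [integral_div, integral_add hθ2 hv2] at h3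
    rw [scalarL2Sq]; linarith
  have i2 : ∫ y, |θ r y| ≤ (1 + scalarL2Sq (θ r)) / 2 := by
    have h3 : ∫ y, |θ r y| ≤ ∫ y, (1 + θ r y ^ 2) / 2 :=
      integral_mono hθi.abs (((integrable_const (1 : ℝ)).add hθ2).div_const 2) fun y => by
        dsimp only; nlinarith [sq_nonneg (|θ r y| - 1), sq_abs (θ r y)]
    rw [integral_div, integral_add (integrable_const _) hθ2, integral_const] at h3
    simp only [probReal_univ, smul_eq_mul, one_mul] at h3
    rw [scalarL2Sq]; linarith
  have hhh : ∫ y, h y * h y = ∫ y, h y ^ 2 := integral_congr_ae (Eventually.of_forall fun y => (sq (h y)).symm)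
  have hH0 : 0 ≤ ∫ y, h y ^ 2 := integral_nonneg fun _ => sq_nonneg _
  calc |(∫ y, θ r y * (⟪u r y, FunctionSpaces.Torus.gradient h y⟫_ℝ + κ * FunctionSpaces.Torus.laplacian h y)) + ∫ y, h y * h y|
      ≤ |∫ y, θ r y * (⟪u r y, FunctionSpaces.Torus.gradient h y⟫_ℝ + κ * FunctionSpaces.Torus.laplacian h y)| + |∫ y, h y * h y| :=
        abs_add_le _ _
    _ ≤ (∫ y, |θ r y * (⟪u r y, FunctionSpaces.Torus.gradient h y⟫_ℝ + κ * FunctionSpaces.Torus.laplacian h y)|) + ∫ y, h y ^ 2 := by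
        rw [hhh, abs_of_nonneg hH0]
        exact add_le_add abs_integral_le_integral_abs le_rfl
    _ ≤ (∫ y, (Cg * (‖u r y‖ * |θ r y|) + κ * Cl * |θ r y|)) + ∫ y, h y ^ 2 :=
        add_le_add (integral_mono_of_nonneg (Eventually.of_forall fun y => abs_nonneg _)
          ((hav'.const_mul Cg).add (hθi.abs.const_mul _)) (Eventually.of_forall hpt)) le_rfl
    _ = Cg * (∫ y, ‖u r y‖ * |θ r y|) + κ * Cl * (∫ y, |θ r y|) + ∫ y, h y ^ 2 := by
        rw [integral_add (hav'.const_mul Cg) (hθi.abs.const_mul _), MeasureTheory.integral_const_mul,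
          MeasureTheory.integral_const_mul]
    _ ≤ Cg * ((scalarL2Sq (θ r) + ∫ y, ‖u r y‖ ^ 2) / 2) + κ * Cl * ((1 + scalarL2Sq (θ r)) / 2) + ∫ y, h y ^ 2 :=
        add_le_add (add_le_add (mul_le_mul_of_nonneg_left i1 hCg0) (mul_le_mul_of_nonneg_left i2 (mul_nonneg hκ hCl0))) le_rfl
    _ = Cg * (scalarL2Sq (θ r) + ∫ y, ‖u r y‖ ^ 2) / 2 + κ * Cl * (1 + scalarL2Sq (θ r)) / 2 + ∫ y, h y ^ 2 := by ring

/-- The trace integrand in absolute value is integrable on every `(0, T]`. [folklore] -/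
theorem integrableOn_abs_traceDeriv (hθ : IsWeakScalarTransportForced κ u (fun _ => h) θ₀ θ)
    (hh : FunctionSpaces.Torus.IsSmooth h) (T : ℝ) :
    IntegrableOn (fun τ => |(∫ y, θ τ y *
        (⟪u τ y, FunctionSpaces.Torus.gradient h y⟫_ℝ + κ * FunctionSpaces.Torus.laplacian h y)) + ∫ y, h y * h y|)
      (Ioc 0 T) volume := by
  rcases le_or_gt T 0 with hT | hT
  · rw [Ioc_eq_empty (not_lt.2 hT)]; exact integrableOn_empty
  · have h1 : IntegrableOn (fun τ => |(∫ y, θ τ y *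
        (⟪u τ y, FunctionSpaces.Torus.gradient h y⟫_ℝ + κ * FunctionSpaces.Torus.laplacian h y)) + ∫ y, h y * h y|)
        (Ioo 0 T) volume := (integrableOn_traceDeriv hθ hh hT).abs
    exact h1.congr_set_ae Ioo_ae_eq_Ioc.symm

end Budget

end Torus

end Literature.Analysis.FluidPDE
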